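import Summits.NavierStokesRegularity.NavierStokesRegularity.Theses.FrozenSignCascade
import Summits.NavierStokesRegularity.NavierStokesRegularity.Theses.TypeILiouville
import Summits.NavierStokesRegularity.NavierStokesRegularity.Theorems.FrozenSignCascadeBoundedEnvelopeContinuationMorreyOfEnvelope
import Summits.NavierStokesRegularity.NavierStokesRegularity.Theorems.FrozenSignCascadeBoundedEnvelopeContinuationStateOfKato
import Summits.NavierStokesRegularity.NavierStokesRegularity.Theorems.FrozenSignCascadeBoundedEnvelopeContinuationClayOfBackwardBounded
import Summits.NavierStokesRegularity.NavierStokesRegularity.Theorems.FrozenSignCascadeBoundedEnvelopeContinuationZoomLimitMorrey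
import Summits.NavierStokesRegularity.NavierStokesRegularity.Theorems.FrozenSignCascadeBoundedEnvelopeContinuationRecordSequence
import Summits.NavierStokesRegularity.NavierStokesRegularity.Theorems.FrozenSignCascadeBoundedEnvelopeContinuationNearFinalPersistence
import Summits.NavierStokesRegularity.NavierStokesRegularity.Theorems.FrozenSignCascadeBoundedEnvelopeContinuationLiouvilleMorreyOfL
import Summits.NavierStokesRegularity.NavierStokesRegularity.Theorems.LiouvilleConjectureNS
import Literature.Analysis.FluidPDE.NSCriticalClosureBesovKatoClass
import Literature.Analysis.FluidPDE.NSBoundedMildOseen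
import Literature.Analysis.FluidPDE.SelfSimilar
import HarnessLib

/-!
# Route FrozenSignCascade · crux `BoundedEnvelopeContinuation` (stmt-NavierStokesRegularity-10579)
(conditional proofs: (B) holds under the Liouville statement (L_M), hence under the
Koch–Nadirashvili–Seregin–Šverák Liouville conjecture (L))

**Theorem (`boundedEnvelopeContinuation_of_liouvilleMorrey`).** Assume the Liouville statement

  (L_M) every bounded ancient mild solution of Navier–Stokes (`ν = 1`) on `(-∞,0) × ℝ³` which is
        jointly smooth and Oseen-mild there and whose slices obey a uniform scale-invariant Morrey
        bound `∫_{B_r(y)} ‖v t‖² ≤ M' r` at ALL radii vanishes identically.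

Then the route decl
`Summit.NavierStokesRegularity.NavierStokesRegularity.Theses.FrozenSignCascade.BoundedEnvelopeContinuation`
holds: for `ν > 0` and a Clay datum `u₀`, if at every horizon `T₀` the critical Fourier envelope
`‖ξ‖² ‖V(t,ξ)‖` of all Fourier-side mild solutions `V` on `[0,T]`, `T ≤ T₀`, from `𝓕⁻¹u₀` is
bounded by one constant, then `u₀` launches a global smooth bounded-energy (Clay) solution.

**Corollaries.** (L_M) is implied by the Liouville conjecture (L) of KNSS 2009 (a.e.-constant
slices; a constant with a Morrey bound at all radii is `0`: `stub_liouvilleMorreyOfL`), so (B)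
holds under (L) VERBATIM (`boundedEnvelopeContinuation_of_liouville`), under the canonical
conjecture leaf `LiouvilleConjectureNS` (`boundedEnvelopeContinuation_of_liouvilleConjectureNS`),
and under the route item `TypeILiouville.TypeIliouvilleL` (stmt-NavierStokesRegularity-10661,
`boundedEnvelopeContinuation_of_typeIliouvilleL`).

**Why (the mathematics).** A bounded critical envelope `|û(t,ξ)| ≤ C|ξ|⁻²` (`u(t) ∈ PM²`) places
every slice in the critical Morrey class `∫_{B_r(x₁)} |u(t)|² ≤ κ C² r` (`stub_morreyOfEnvelope`,
landed by lead c1). Every classical Leray–Hopf solution from the datum on `[0,T)` is the Kato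
solution, identified on each `[0,Tt]`, `Tt < T`, with the Tao-class state of `stub_stateOfKato`
(Kato uniqueness in `C_t L³`), which exposes its Fourier side (so the envelope hypothesis applies)
and bounds it on closed sub-slabs (Sobolev). Were `u` not backward bounded at some `(T, x₀)`, the
KOCH–NADIRASHVILI–SEREGIN–ŠVERÁK RECORD ZOOM applies: near-maximum points `(tc n, xc n)` with
levels `Λ n → ∞` (`stub_recordSequence`); the sup-normalised viscosity-normalising zooms
`(Λ n)⁻¹ u(tc n + ν s/(Λ n)², xc n + (ν/Λ n) y)` are classical solutions with viscosity `1`,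
bounded by `2`, Oseen-mild, and converge along a subsequence (KNSS 2009, Lemma 6.1) to a bounded
ancient mild solution `v`, smooth and Oseen-mild, which inherits the scale-invariant Morrey bound at
ALL radii (`stub_zoomLimitMorrey`) and is NONZERO at one negative time (uniform `1/4`-Hölder
modulus of bounded Oseen-mild fields up to the final time, where the zoom has norm `1`:
`stub_nearFinalPersistence`) — contradicting (L_M). So every classical Leray–Hopf solution from the
datum is backward bounded at every final-time point, and `stub_clayOfBackwardBounded` (lead c1:
infinite Kato maximal time ⇒ Clay solution) concludes.

In words: **every blow-up compatible with hypothesis (B) zooms to a Morrey-bounded bounded ancient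
mild solution**, so (B) is the `PM²` shadow of the Liouville problem for such solutions. That
Liouville problem is the Type-I exclusion problem in its ancient form (Barker–Prange 2020, §1.3:
"if `u^(∞)` is a constant satisfying the global Morrey bound then it must be zero. Consequently the
validity of the Liouville conjecture (C1) would imply that if one has a Type I singularity at `T`,
the resulting mild bounded ancient solution must be zero", and conversely "failure of (C1) for mild
bounded ancient solutions satisfying the global Morrey bound implies Type I singularity formation"
by Albritton–Barker 2019): it is implied by (L) and, via the Albritton–Barker characterisation, by
the non-existence of Type I singular points. This file is a CONDITIONAL result (`--supports` the
crux item; it does not close it).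

Sources: G. Koch, N. Nadirashvili, G. Seregin, V. Šverák, Acta Math. 203 (2009) = arXiv:0709.3599,
§1 (L), Lemma 6.1, Prop. 4.1, §6; T. Barker, C. Prange, Arch. Ration. Mech. Anal. 235 (2020)
= arXiv:1906.08225, §1.3; D. Albritton, T. Barker, J. Math. Fluid Mech. 21 (2019), Thm. 1.1;
P. G. Lemarié-Rieusset, *The Navier–Stokes problem in the 21st century* (2016), Thm. 15.1.
-/

noncomputable section

set_option linter.dupNamespace false -- nested layout Summit.<S>.<Sub>, Sub = S (D-0017)

open Set MeasureTheory Filter Topology Metric Function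
open scoped ENNReal
open Literature.Analysis Literature.Analysis.FluidPDE Literature.Analysis.FluidPDE.FourierNS

namespace Summit.NavierStokesRegularity.NavierStokesRegularity.Theorems.BoundedEnvelope

/-- **Crux (B) of route `FrozenSignCascade` from the Liouville statement (L_M)** (statement and
proof in the module docstring): composition of the landed stubs `stub_morreyOfEnvelope`,
`stub_stateOfKato`, `stub_recordSequence`, `stub_zoomLimitMorrey`, `stub_nearFinalPersistence`,
`stub_clayOfBackwardBounded`.
[cite: KochNadirashviliSereginSverak2009, Lemma 6.1 and Prop. 4.1 (arXiv:0709.3599); LemarieRieusset2016, Thm. 15.1 (C)] -/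
theorem boundedEnvelopeContinuation_of_liouvilleMorrey
    (hLM : ∀ v : ℝ → EuclideanSpace ℝ (Fin 3) → EuclideanSpace ℝ (Fin 3),
      IsBoundedAncientMildSolution 1 v →
      ContDiffOn ℝ (⊤ : ℕ∞) (uncurry v) (Set.Iio 0 ×ˢ Set.univ) →
      (∀ s t : ℝ, s < t → t < 0 → ∀ x,
        v t x = UnboundedOperators.heatExtension (v s) (t - s) x - oseenDuhamel 1 s v v t x) →
      (∃ M' : ℝ, ∀ t < 0, ∀ (y : EuclideanSpace ℝ (Fin 3)) (r : ℝ), 0 < r →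
        ∫ x in Metric.ball y r, ‖v t x‖ ^ 2 ≤ M' * r) →
      ∀ t < 0, ∀ x, v t x = 0) :
    Summit.NavierStokesRegularity.NavierStokesRegularity.Theses.FrozenSignCascade.BoundedEnvelopeContinuation := by
  intro ν hν u₀ hu hd hdiv hbdd
  refine stub_clayOfBackwardBounded ν hν u₀ hu hd hdiv ?_
  intro T hT u p hsol hLH hu0 x₀
  -- the classical Leray–Hopf solution is a Kato solution on `[0, T)`
  have hLH' : IsLerayHopfOn T ν 0 (u 0) u := by rw [hu0]; exact hLH
  have hd0 : HasRapidSpatialDecay (u 0) := by rw [hu0]; exact hd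
  have hK : IsKatoSolutionOn T ν u₀ u := by
    have h := isKatoSolutionOn_of_classical hν hT hsol hLH' hd0
    rwa [hu0] at h
  -- the envelope constant at horizon `T` and the Morrey constant
  obtain ⟨C, hC⟩ := hbdd T hT
  obtain ⟨κ, _, hMor⟩ := stub_morreyOfEnvelope
  -- Tao-class states with Fourier side on `[0, Tt]`, `Tt < T`, identified with `u`
  have hstate : ∀ Tt : ℝ, 0 < Tt → Tt < T →
      ∃ (u' : ℝ → EuclideanSpace ℝ (Fin 3) → EuclideanSpace ℝ (Fin 3))
        (p' : ℝ → EuclideanSpace ℝ (Fin 3) → ℝ) (V : ℝ → EuclideanSpace ℝ (Fin 3) → Fin 3 → ℂ),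
        IsTaoSolutionOn Tt ν u₀ u' p' ∧ IsFourierMild (4 * Real.pi ^ 2 * ν) 4 0 Tt V ∧
        (∀ t ∈ Icc 0 Tt, u' t = synthVel (V t)) ∧ V 0 = fourierData hu hd ∧
        ∀ t ∈ Icc 0 Tt, u' t = u t := by
    intro Tt hTt0 hTtT
    obtain ⟨u', p', V, hTao, hV, hsyn, hV0⟩ :=
      stub_stateOfKato ν hν u₀ hu hd hdiv T u hK Tt hTt0 hTtT
    refine ⟨u', p', V, hTao, hV, hsyn, hV0, fun t htI => ?_⟩
    have hae : u' t =ᵐ[volume] u t :=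
      hTao.ae_eq_of_kato_Icc hν hTt0 (hK.mild.mono (Ico_subset_Ico_right hTtT.le))
        (hK.continuousInLpOn.mono fun s hs => ⟨hs.1, lt_of_le_of_lt hs.2 hTtT⟩)
        (hK.aestronglyMeasurable.mono_measure (Measure.restrict_mono
          (Set.prod_mono (Ioo_subset_Ioo_right hTtT.le) Subset.rfl) le_rfl)) t htI
    exact (Continuous.ae_eq_iff_eq volume (hTao.classical.contDiff_velocity htI).continuous
      (hsol.contDiff_velocity ⟨htI.1, lt_of_le_of_lt htI.2 hTtT⟩).continuous).1 hae
  -- boundedness of `u` on closed sub-slabs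
  have hbd : ∀ t < T, ∃ B : ℝ, ∀ s ∈ Icc 0 t, ∀ x, ‖u s x‖ ≤ B := by
    intro t htT
    set Tt : ℝ := (max t 0 + T) / 2 with hTt
    have hTt0 : 0 < Tt := by
      rw [hTt]; linarith [le_max_right t 0]
    have hTtT : Tt < T := by
      rw [hTt]
      have : max t 0 < T := max_lt htT hT
      linarith
    have htTt : t ≤ Tt := by
      rw [hTt]
      have : max t 0 < T := max_lt htT hT
      linarith [le_max_left t 0]
    obtain ⟨u', p', V, hTao, -, -, -, heq⟩ := hstate Tt hTt0 hTtT
    obtain ⟨B, -, hB⟩ := hTao.exists_bound_velocity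
    refine ⟨B, fun s hs x => ?_⟩
    rw [← heq s ⟨hs.1, hs.2.trans htTt⟩]
    exact hB s ⟨hs.1, hs.2.trans htTt⟩ x
  -- the Morrey bound on every slice `0 < t < T`
  have hMorrey : ∀ t ∈ Ioo 0 T, ∀ (x₁ : EuclideanSpace ℝ (Fin 3)) (r : ℝ), 0 < r → 17 * r ≤ 1 →
      ∫ x in ball x₁ r, ‖u t x‖ ^ 2 ≤ κ * C ^ 2 * r := by
    intro t ht x₁ r hr _
    set Tt : ℝ := (t + T) / 2 with hTt
    have hTt0 : 0 < Tt := by rw [hTt]; linarith [ht.1, ht.2]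
    have htTt : t < Tt := by rw [hTt]; linarith [ht.2]
    have hTtT : Tt < T := by rw [hTt]; linarith [ht.2]
    obtain ⟨u', p', V, hTao, hV, hsyn, hV0, heq⟩ := hstate Tt hTt0 hTtT
    have htI : t ∈ Icc 0 Tt := ⟨ht.1.le, htTt.le⟩
    have henv : ∀ ξ : EuclideanSpace ℝ (Fin 3), ‖ξ‖ ^ 2 * ‖V t ξ‖ ≤ C :=
      fun ξ => hC Tt hTtT.le V hV hV0 t htI ξ
    have hC0 : 0 ≤ C := le_trans (by positivity) (henv 0)
    have hdecV : ∀ K : ℕ, ∃ B, HasDecay K B (V t) := fun K => by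
      obtain ⟨B, hB⟩ := hV.decay K
      exact ⟨B, hB t⟩
    have hm := hMor C (V t) hC0 (hV.continuous_slice t) hdecV (fun ξ l => hV.conjSymm t ξ l) henv
      x₁ r hr
    rw [← heq t htI, hsyn t htI]
    exact hm
  -- suppose `(T, x₀)` were not backward bounded: record points, zooms, the ancient limit
  by_contra hnot
  have hcont : ContinuousOn (uncurry u) (Ico 0 T ×ˢ univ) := hsol.smooth_velocity.continuousOn
  obtain ⟨tc, xc, Λ, e, htc, he, hte, hΛ, hΛeq, hdom, hΛlim, hprod⟩ :=
    stub_recordSequence T hT u hcont hbd x₀ hnot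
  obtain ⟨z, hz⟩ : ∃ z : ℕ → ℝ → EuclideanSpace ℝ (Fin 3) → EuclideanSpace ℝ (Fin 3),
      ∀ n s y, z n s y = (Λ n)⁻¹ • u (tc n + ν / Λ n ^ 2 * s) (xc n + (ν / Λ n) • y) :=
    ⟨fun n s y => (Λ n)⁻¹ • u (tc n + ν / Λ n ^ 2 * s) (xc n + (ν / Λ n) • y), fun _ _ _ => rfl⟩
  obtain ⟨s₀, hs₀, hpers⟩ := stub_nearFinalPersistence ν T hν hT u p hsol hLH' tc xc Λ e htc he hte
    hΛ hΛeq hdom hprod z hz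
  obtain ⟨φ, v, hφ, hpt, hmild, hsm, hoseen, hMv⟩ := stub_zoomLimitMorrey ν T hν hT u p hsol hLH'
    (κ * C ^ 2) hMorrey tc xc Λ e htc he hte hΛ hdom hΛlim hprod z hz
  -- the limit is nonzero at `(s₀, 0)` …
  have hlow : (1 / 2 : ℝ) ≤ ‖v s₀ 0‖ :=
    ge_of_tendsto ((hpt s₀ hs₀ 0).norm) ((hφ.tendsto_atTop).eventually hpers)
  -- … and zero by (L_M)
  have hzero : v s₀ 0 = 0 := hLM v hmild hsm hoseen hMv s₀ hs₀ 0
  rw [hzero, norm_zero] at hlow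
  norm_num at hlow

/-- **Crux (B) under the Liouville conjecture (L) of Koch–Nadirashvili–Seregin–Šverák 2009,
verbatim** ("every bounded ancient mild solution has a.e.-constant slices"): (L) implies (L_M)
(`stub_liouvilleMorreyOfL`). [cite: KochNadirashviliSereginSverak2009, §1 conjecture (L) (arXiv:0709.3599)] -/
theorem boundedEnvelopeContinuation_of_liouville
    (hL : ∀ u : ℝ → EuclideanSpace ℝ (Fin 3) → EuclideanSpace ℝ (Fin 3),
      IsBoundedAncientMildSolution 1 u → (∀ t < 0, AEStronglyMeasurable (u t) volume) →
        ∀ t < 0, ∃ b : EuclideanSpace ℝ (Fin 3), u t =ᵐ[volume] fun _ => b) :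
    Summit.NavierStokesRegularity.NavierStokesRegularity.Theses.FrozenSignCascade.BoundedEnvelopeContinuation :=
  boundedEnvelopeContinuation_of_liouvilleMorrey (stub_liouvilleMorreyOfL hL)

/-- **Crux (B) under the canonical conjecture leaf `LiouvilleConjectureNS`.**
[cite: KochNadirashviliSereginSverak2009, §1 conjecture (L) (arXiv:0709.3599)] -/
theorem boundedEnvelopeContinuation_of_liouvilleConjectureNS
    (hL : Summit.NavierStokesRegularity.NavierStokesRegularity.LiouvilleConjectureNS) :
    Summit.NavierStokesRegularity.NavierStokesRegularity.Theses.FrozenSignCascade.BoundedEnvelopeContinuation :=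
  boundedEnvelopeContinuation_of_liouville hL

/-- **Crux (B) under the route item `TypeILiouville.TypeIliouvilleL`** (stmt-NavierStokesRegularity-10661;
its definiens is (L) verbatim): an in-tree PROVED implication between two crux items of two routes.
[cite: KochNadirashviliSereginSverak2009, §1 conjecture (L) (arXiv:0709.3599)] -/
theorem boundedEnvelopeContinuation_of_typeIliouvilleL
    (hL : Summit.NavierStokesRegularity.NavierStokesRegularity.Theses.TypeILiouville.TypeIliouvilleL) :
    Summit.NavierStokesRegularity.NavierStokesRegularity.Theses.FrozenSignCascade.BoundedEnvelopeContinuation :=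
  boundedEnvelopeContinuation_of_liouville hL


/-- **Registered stub `stub_ofLiouvilleMorrey` of the line's skeleton** (crux
stmt-NavierStokesRegularity-10579, `Cruxes/BoundedEnvelopeContinuation/Lines/birth.lean`): the
implication (L_M) ⇒ `BoundedEnvelopeContinuation`, by name, so that the skeleton's composition
`BoundedEnvelopeContinuation_of := stub_ofLiouvilleMorrey stub_liouvilleMorrey` is closed modulo the
single open stub `stub_liouvilleMorrey` (L_M).
[cite: KochNadirashviliSereginSverak2009, Lemma 6.1 and Prop. 4.1 (arXiv:0709.3599)] -/
theorem stub_ofLiouvilleMorrey :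
    (∀ v : ℝ → EuclideanSpace ℝ (Fin 3) → EuclideanSpace ℝ (Fin 3),
      IsBoundedAncientMildSolution 1 v →
      ContDiffOn ℝ (⊤ : ℕ∞) (uncurry v) (Set.Iio 0 ×ˢ Set.univ) →
      (∀ s t : ℝ, s < t → t < 0 → ∀ x,
        v t x = UnboundedOperators.heatExtension (v s) (t - s) x - oseenDuhamel 1 s v v t x) →
      (∃ M' : ℝ, ∀ t < 0, ∀ (y : EuclideanSpace ℝ (Fin 3)) (r : ℝ), 0 < r →
        ∫ x in Metric.ball y r, ‖v t x‖ ^ 2 ≤ M' * r) →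
      ∀ t < 0, ∀ x, v t x = 0) →
    Summit.NavierStokesRegularity.NavierStokesRegularity.Theses.FrozenSignCascade.BoundedEnvelopeContinuation :=
  boundedEnvelopeContinuation_of_liouvilleMorrey

/-- **Registered stub `stub_ofLiouville` of the line's skeleton**: the implication
(L) verbatim (= item `TypeILiouville.TypeIliouvilleL`, stmt-NavierStokesRegularity-10661) ⇒
`BoundedEnvelopeContinuation`, by name. [cite: KochNadirashviliSereginSverak2009, §1 conjecture (L) (arXiv:0709.3599)] -/
theorem stub_ofLiouville :
    (∀ u : ℝ → EuclideanSpace ℝ (Fin 3) → EuclideanSpace ℝ (Fin 3),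
      IsBoundedAncientMildSolution 1 u → (∀ t < 0, AEStronglyMeasurable (u t) volume) →
        ∀ t < 0, ∃ b : EuclideanSpace ℝ (Fin 3), u t =ᵐ[volume] fun _ => b) →
    Summit.NavierStokesRegularity.NavierStokesRegularity.Theses.FrozenSignCascade.BoundedEnvelopeContinuation :=
  boundedEnvelopeContinuation_of_liouville

end Summit.NavierStokesRegularity.NavierStokesRegularity.Theorems.BoundedEnvelope

end
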